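import Summits.BirchSwinnertonDyer.BirchSwinnertonDyer.Theses.GenusKolyvaginAtTwo
import Summits.BirchSwinnertonDyer.BirchSwinnertonDyer.Theorems.GenusKolyvaginAtTwoMultiGenusPrimitivityAtTwoDepthLaw

/-!
# Route `GenusKolyvaginAtTwo`, crux stmt-BirchSwinnertonDyer-24947 `MultiGenusPrimitivityAtTwo` (U): the crux BY NAME from the
# REDUCED-GENUS-INDEX form (depth-2 levels), via the depth law of `…MultiGenusPrimitivityAtTwoDepthLaw`

Lead prover seat bsd-line-gk2-p1 (g5). `…DepthLaw` (route-independent, ns `…Theorems.GenusKoly`) proves that at a square-free level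
`n` of Kolyvagin primes at `2` with `4 ∣ a_ℓ` (`ℓ ∣ n`) the crux's certificate `Σ_{g∈T} g·y(n) ∉ 2E(K[n])` is EQUIVALENT to
`Y_n ∉ 2^{r+1}E(K[n])` for the single top genus-character component `Y_n` (the Heegner datum of the genus twist `E^{(n*)}/K`),
unconditionally. This file records the consequence for the item: crux 24947 `MultiGenusPrimitivityAtTwo` follows BY NAME from its
REDUCED-GENUS-INDEX form «on the crux's frame some depth-2 level carries a top genus component outside `2^{r+1}E(K[n])`» — the
hypothesis `hred` below, whose binders are the crux's VERBATIM. CONDITIONAL on `hred` (the open kernel: exact `2`-adic index of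
the genus Heegner point of a 2-Selmer-minimal genus pair = W. Zhang's theorem at `p = 2`, plus its Mazur–Rubin supply); the same
one-line composition serves the `DEF = 1` / ∃K re-typings (pointwise lemma `heegner_exists_multiGenusCertificate_of_reducedGenusIndex`).
Helper (`--supports stmt-BirchSwinnertonDyer-24947`); BSD is not proved by any of this.
-/

set_option linter.dupNamespace false -- tree convention: `Summit.BirchSwinnertonDyer.BirchSwinnertonDyer.Theorems` (summit = sub-problem)

noncomputable section

open scoped Classical

namespace Summit.BirchSwinnertonDyer.BirchSwinnertonDyer.Theorems.GenusKoly

open Finset NumberField WeierstrassCurve Literature.NumberTheory.EllipticCurves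
  Literature.NumberTheory.EllipticCurves.ModularForms

/-! ## §6 Crux 24947 BY NAME from the reduced-genus-index form -/

section Crux

open Summit.BirchSwinnertonDyer.BirchSwinnertonDyer.Theses.GenusKolyvaginAtTwo

/-- **`MultiGenusPrimitivityAtTwo` (crux 24947) from «some depth-2 level has a `2`-primitive reduced genus Heegner point».**
The hypothesis is the crux's own binder list VERBATIM up to (and including) the twin clause, concluding
`∃ n d θ G, [n square-free of Kolyvagin primes at 2 with 4 ∣ a_ℓ] ∧ [θ_ℓ² = ℓ*] ∧ [G = 𝒢_n] ∧ Y_n ∉ 2^{r+1}E(K[n])` — i.e. the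
REDUCED-GENUS-INDEX form of U (one genus Heegner point of the twist `E^{(n*)}`, at its BSD-predicted minimal depth `r`); §5 turns it
into the certificate. CONDITIONAL on that hypothesis (the open kernel, W. Zhang's theorem at `p = 2` for a 2-Selmer-minimal genus
pair plus its Mazur–Rubin supply); nothing else. [cite: GrossLMS1991, §3 (3.5), Prop. 3.7 (1), §4 (4.1), Lemma 4.3]
[cite: WZhang2014, Thm. 1.1 (the p ≥ 5 prototype)] -/
theorem multiGenusPrimitivityAtTwo_of_reducedGenusIndex
    (hred : ∀ (W : WeierstrassCurve ℚ) [W.IsElliptic] [W.IsGloballyMinimal] [NeZero (W.conductorNorm ℤ)], ¬ W.HasCM →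
      W.analyticRank = 0 → (∀ n : ℕ, 0 < n → W.HasSurjectiveModNGaloisRep ((2 : ℤ) ^ n)) → Odd W.tamagawaProduct →
      ∀ (K : Type) [Field K] [NumberField K], Literature.NumberTheory.EllipticCurves.IsImaginaryQuadratic K →
      Odd (NumberField.discr K) → NumberField.discr K ≠ -3 →
      Literature.NumberTheory.EllipticCurves.SatisfiesHeegnerHypothesis (W.conductorNorm ℤ) K →
      ¬ IsSquare ((NumberField.discr K : ℚ) * -|W.Δ|) → ¬ IsSquare ((NumberField.discr K : ℚ) * (-(2 * |W.Δ|))) →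
      ∀ (Dt : Literature.NumberTheory.EllipticCurves.ModularForms.ModularParametrizationData W (W.conductorNorm ℤ)),
      (∀ z ∈ Dt.L.lattice, ∃ w ∈ Literature.NumberTheory.EllipticCurves.ModularForms.periodLattice Dt.f, z = (Dt.c : ℂ) * w) →
      Odd Dt.c → ∀ (β : ℤ) (ι : K →+* ℂ) (d₁ : Literature.NumberTheory.EllipticCurves.KolyvaginHeegnerData Dt β ι 1),
      ¬ IsOfFinAddOrder d₁.derivedPoint → ∀ (Wd : WeierstrassCurve ℚ) [Wd.IsElliptic] [Wd.IsGloballyMinimal],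
      (∃ C : WeierstrassCurve.VariableChange ℚ, C • W.quadraticTwist (NumberField.discr K : ℚ) = Wd) → Wd.analyticRank = 1 →
      Nat.card (Wd.selmerGroup 2) = 2 →
      ∃ (n : ℕ) (d : Literature.NumberTheory.EllipticCurves.KolyvaginHeegnerData Dt β ι n)
        (θ : ℕ → Literature.NumberTheory.EllipticCurves.ringClassField K ι n)
        (G : Finset (Literature.NumberTheory.EllipticCurves.ringClassField K ι n ≃ₐ[ℚ]
          Literature.NumberTheory.EllipticCurves.ringClassField K ι n)),
        Squarefree n ∧
        (∀ ℓ ∈ n.primeFactors, Literature.NumberTheory.EllipticCurves.Zhang2014.IsKolyvaginPrime (W.conductorNorm ℤ) W K 2 ℓ) ∧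
        (∀ ℓ ∈ n.primeFactors, (4 : ℤ) ∣ W.frobeniusTrace ℓ) ∧
        (∀ ℓ ∈ n.primeFactors, θ ℓ ^ 2 =
          algebraMap ℚ (Literature.NumberTheory.EllipticCurves.ringClassField K ι n) ((-1 : ℚ) ^ (ℓ / 2) * ℓ)) ∧
        (∀ g, g ∈ G ↔ g ∈ Literature.NumberTheory.EllipticCurves.ringClassGal ι n) ∧
        ¬ ∃ Q : (W.baseChange (Literature.NumberTheory.EllipticCurves.ringClassField K ι n)).toAffine.Point,
          ((2 : ℤ) ^ (n.primeFactors.card + 1)) • Q =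
            ∑ g ∈ G, (∏ ℓ ∈ n.primeFactors, (if g (θ ℓ) = θ ℓ then (1 : ℤ) else -1)) •
              Literature.NumberTheory.EllipticCurves.pointGalHom W
                (Literature.NumberTheory.EllipticCurves.ringClassField K ι n) g d.y) :
    MultiGenusPrimitivityAtTwo := by
  intro W _ _ _ hcm hr0 hρ hT K _ _ hIQ hodd h3 hHe hsq1 hsq2 Dt hopt hc β ι d₁ hy Wd _ _ hWd hrd hSel
  have hsurj : W.HasSurjectiveModNGaloisRep ((2 : ℤ) ^ 1) := hρ 1 one_pos
  exact heegner_exists_multiGenusCertificate_of_reducedGenusIndex hIQ hodd h3 hHe hsurj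
    (hred W hcm hr0 hρ hT K hIQ hodd h3 hHe hsq1 hsq2 Dt hopt hc β ι d₁ hy Wd hWd hrd hSel)

end Crux

end Summit.BirchSwinnertonDyer.BirchSwinnertonDyer.Theorems.GenusKoly

end
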